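import Mathlib
import Literature.Geometry.Symplectic.HondaUntwistedModel
import HarnessLib

/-!
# Taubes' finite-energy pseudo-holomorphic subvarieties of `S¹ × (B³ ∖ 0)` for the degenerate pair
# `(ω, J)`: definitions and the structure theorem near the zero circle

Trunk `Literature/Geometry/Symplectic` (on top of `HondaUntwistedModel.lean`, whose
`hondaFormA` / `hondaDualVec` / `hondaTube` / `hondaAxis` on `ℝ_t × ℝ³ = EuclideanSpace ℝ (Fin 4)`
are reused; next to `NearSymplecticPuncturedSphere.lean`, `NearSymplecticFlatBirth.lean`).
One definition and four NAMED FACTS (D-0014) from C. H. Taubes, Geom. Topol. 2 (1998) 221–332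
[T98], requested by route `SmoothPoincare4/SullivanDual`, crux `HyperbolicEnd`
(`stmt-SmoothPoincare4-7825`), line `taubes-circle-pencil`, stub S4 (the single most load-bearing
missing published input of every structural argument at the zero set `Z` there).  Nothing is
asserted: the facts are closed `def … : Prop`; users take `(h : taubes_finiteEnergy_regularPoints)`
etc.

## The setting of [T98] §1 and how it is transcribed

[T98] works on `X = S¹ × B³`, `t` the coordinate on the circle, `(x, y, z)` Euclidean coordinates
on the 3-ball, with the closed self-dual 2-form (1.1)
`ω = dt ∧ (x dx + y dy − 2z dz) + x dy∧dz − y dx∧dz − 2z dx∧dy` (the tree's `hondaFormA`, character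
for character), vanishing exactly on `Z = S¹ × {0}` ((1.2): `ω ∧ ω = 2(x² + y² + 4z²) dt dx dy dz`;
`hondaAxis` upstairs), its norm function (1.3) `g = (x² + y² + 4z²)^{1/2}` (`|ω| = √2 g`), the
product flat metric, and the singular almost complex structure `J` of (1.4) on `X ∖ Z`,
"`ω`-compatible as `√2 ω(·, J(·))/|ω|` gives back the product, flat metric".

* **Periodic lift.**  We record everything on the universal cover in `t`: points
  `w = (t, x, y, z) = (w 0, w 1, w 2, w 3)` of `ℝ⁴ = EuclideanSpace ℝ (Fin 4)`, whose Euclidean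
  metric IS the product flat metric, the circle being `ℝ/2πℤ` (period vector `2π ∂_t`; the tree's
  and Honda's normalisation — [T98] writes `S¹ = ℝ/ℤ` in §1.c and §2) and the ball having any
  radius `δ > 0` (the punctured tube `X_δ = {0 < x² + y² + z² < δ²}`).  A subvariety of
  `S¹ × (B³(δ) ∖ 0)` is a `2π ∂_t`-invariant subset `C ⊆ X_δ`; its energy / area is that of one
  period `C ∩ {0 ≤ t < 2π}`; balls about a point `(t₀, 0)` of `Z` are Euclidean balls of `ℝ⁴`
  (they see one period for radius `< π`), and the dilations (3.1) about `(t₀, 0)` are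
  `w ↦ s⁻¹(w − w₀)`.  [T98]'s literal domain (period `1`, unit ball) is, after the dilation
  `w ↦ 2πw` (which multiplies `ω` by `(2π)³` and preserves `J`, finiteness of energy and every
  conclusion below), the case `δ = 2π`; `δ > 2π` follows by restriction (a finite-energy
  subvariety of a wider tube restricts to one of `X_{2π}`, and `g ≥ 2π` outside it); for
  `δ < 2π` the statements are [T98]'s read for a thinner tube — all hypotheses and conclusions
  recorded here concern `C ∩ {x² + y² + z² < s²}` for small `s`, and the proofs of [T98] §§2–9
  use of the ambient space only the model `(ω, J, g)` near `Z` and the compactness of `Z`.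
* **Sign of `J`.**  As printed, (1.4) has `J ∂_t = −g⁻¹(x ∂_x + y ∂_y − 2z ∂_z)`, for which
  `ω(∂_t, J ∂_t) = −g < 0`, contradicting the compatibility sentence quoted above and the
  positivity "`ω|_{TC} > 0`" (after Def. 1.2), "`ω` on `TC` is equal to `g` times the area form of
  the induced metric" (§2, proof of Prop. 2.1) used throughout.  We write the `ω`-compatible
  sign `J := −(1.4)`: `J ∂_t = g⁻¹(x ∂_x + y ∂_y − 2z ∂_z)`, `J ∂_x = −g⁻¹(x ∂_t + 2z ∂_y + y ∂_z)`,
  `J ∂_y = g⁻¹(−y ∂_t + 2z ∂_x + x ∂_z)`, `J ∂_z = g⁻¹(2z ∂_t + y ∂_x − x ∂_y)`, i.e.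
  `J u = g⁻¹ · hondaDualVec w u` (the tree's `J_q = Ω_qᵀ`, with `ω_A(U, J_q U) = g² |U|²` PROVED as
  `hondaFormA_hondaDualVec`), for which `J² = −1` and `ω(u, J u) = g |u|²` (this is also the
  Summit-side `taubesJ = J♭` of `SullivanDualHyperbolicEndTaubesModelDefs.lean` read through the
  covering `(t, a, b, c) ↦ ((1 + a) cos t, (1 + a) sin t, b, c)` of the flat solid torus, under
  which `taubesForm` pulls back to (1.1) with `(x, y, z) = (a, b, c)`).  The choice is immaterial
  for everything below: a subset is the image of a `J`-holomorphic map of a Riemann surface iff it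
  is the image of a `(−J)`-holomorphic map of the conjugate surface, so Def. 1.1 defines the same
  class of SUBSETS for `J` and `−J`, and energy and area are unoriented.
* **Energy and area as measures on the image.**  For a `J`-complex tangent 2-plane with
  orthonormal basis `(e, J e)`, `ω(e, J e) = g`; so for a subvariety `C` with smooth model
  `f : C₀ → X` (an embedding off a countable set, Def. 1.1) `∫_{C₀} f*ω = ∫_C g dℋ²` and the area
  of `C ∩ B` is `ℋ²(C ∩ B)`, `ℋ²` the 2-dimensional Hausdorff measure of the Euclidean `ℝ⁴`
  (Mathlib's `μH[2]` is the un-normalised one, `μH[2] = (4/π) ℋ²` on rectifiable sets; the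
  constant is absorbed in the unspecified constants `ζ` and is invisible in finiteness and
  monotonicity statements — the only kinds recorded).
* **The smooth model** of Def. 1.1 ("a `C^∞` complex curve `C₀`", not necessarily connected)
  is typed as an abstract Hausdorff complex 1-manifold: a type with `ChartedSpace ℂ C₀` and
  `IsManifold 𝓘(ℂ, ℂ) ω C₀` (holomorphic transition maps); `f : C₀ → X_δ` is smooth and
  `J`-holomorphic in every chart of the atlas (`d(f ∘ e⁻¹)(iζ) = J (d(f ∘ e⁻¹) ζ)`), proper, a
  smooth embedding off a countable set `Λ` (topological embedding of `C₀ ∖ Λ` with injective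
  differential there), its image is the lift `C`, and the deck translation `w ↦ w + 2π ∂_t` of the
  lift is induced by a holomorphic homeomorphism `γ` of `C₀` (`f ∘ γ = f + 2π ∂_t`).  This is
  EQUIVALENT to Def. 1.1 for the image of `C` in the quotient `(ℝ/2πℤ) × (B³(δ) ∖ 0)`: the smooth
  model of a subvariety of the quotient pulls back along the covering to such an `(C₀, f, γ)`;
  conversely `γ` acts freely and properly discontinuously (`f ∘ γⁿ = f + 2πn ∂_t`), `C₀/γ^ℤ` is a
  complex curve, and `f` descends to a proper `J`-holomorphic map onto the quotient of `C` that is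
  an embedding off the countable set `(⋃ₙ γⁿ Λ)/γ^ℤ`.  No second-countability is imposed (it
  follows from properness into the `σ`-compact `X_δ`).

## The printed statements and what is recorded

(References "lit p. N" are to the text files `p000N.txt` of `lit read doi:10.2140/gt.1998.2.221`
(`paper-arxiv-math_9901142`, 61 files), not to journal pages.)

1. **Def. 1.1, Def. 1.2 (§1; lit p. 3).**  "A subset `C ⊂ Y` [`= S¹ × (B³ − {0})`] will be
   called a pseudo-holomorphic subvariety if the following is true: • `C` is closed. • There exists
   a `C^∞` complex curve `C₀` together with a proper, `J`-pseudo-holomorphic map `f : C₀ → Y` whose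
   image is `C` and which is an embedding on the complement of a countable set of points in `C₀`."
   "Say that `C` has finite energy when the integral over `C` of `ω` is finite."
   → `IsTaubesFiniteEnergySubvariety δ C`.
2. **Thm. 1.8, first assertion, and Prop. 2.2 (§1.b, §2; lit pp. 4–5, 9).**  "Let `C` be a finite
   energy, pseudo-holomorphic subvariety. Then `C` has finite area …"; Prop. 2.2: "there exists `ζ`
   with the following significance: Fix `s > 0` and let `C(s)` denote the intersection of `C` with
   the subset of `X` where `(ρ² + z²)^{1/2} < s`. Then: (a) `∫_{C(s)} ω ≤ ζ s²` (b) The area of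
   `C(s)` is bounded by `ζ s`."  (Prop. 2.2 is printed for a "submanifold"; it is stated there as an
   immediate corollary of Prop. 2.1, which is about the subvariety `C` fixed at the start of §2.)
   → `taubes_finiteEnergy_finiteArea`.
3. **Prop. 2.1 (§2; lit p. 9), local energy monotonicity.**  With `χ` "a fixed bump function on
   `[0, ∞)`; non-increasing, equals `1` on `[0, 1)` and equals `0` on `[2, ∞)`", `χ_s = χ(r/s)`,
   `r = (t² + ρ² + z²)^{1/2}` the distance to the point `t₀ ∈ Z`, and `σ(s) = ∫_C χ_s ω` (2.2):
   "There exists `ζ > 1` such that for any point `t₀ ∈ Z`, the function `σ` is differentiable on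
   `(0, ζ⁻¹)`. Furthermore, `σ` obeys the inequalities: 1. `σ(s) ≤ ζ s³` 2. The area of
   `C ∩ B(s)` is bounded by `ζ s²`. 3. `(d/ds) σ(s) ≥ (3/s) σ(s)`."  Recorded for every SMOOTH such
   `χ`, with the interval `(0, s₀)`, `s₀ > 0`, not tied to `ζ` (weaker).
   → `taubes_finiteEnergy_localEnergyMonotone`.
4. **Thm. 1.8, main assertion (§1.b; lit pp. 4–5), in the box form of Prop. 7.1 (§7; lit p. 22).**
   "there is a finite set `Z_s ⊂ Z = S¹ × {0}` and a positive integer `N` with the following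
   significance: Let `τ ∈ Z − Z_s`. Then `τ` centers an open ball in `S¹ × B³` whose intersection
   with `C` is a disjoint union of `N` embedded components. Furthermore, the closure of each such
   component is the image of the standard half disk via a real analytic embedding which sends the
   straight edge to `Z` and the interior to the complement of `Z`. Finally, this embedding is
   described by one of the following two possibilities: • The image is the half disk
   `{(t, x, y, z) : (t − τ)² + z² ≤ ε², x = y = 0 and either z ≥ 0 or z ≤ 0}` … • The image is
   that of the half disk `{(t, ρ) : (t − τ)² + ρ² ≤ ε² and ρ ≥ 0}`. The embedding of this half disk
   is defined by functions `(φ = φ(t, ρ), z = z(t, ρ))` via the parametrization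
   `(x = ρ cos φ, y = ρ sin φ, z)`. Here, `(φ, z)` are real analytic functions of `(t, ρ)` which
   obey `φ(t, ρ) = φ₀(t) + O(ρ²)` and `z(t, ρ) = 4⁻¹ φ₀'(t) ρ² + O(ρ⁴)` near `ρ = 0`."  Prop. 7.1:
   "The functions `p` and `q_±` are constant on `Z_R`, and the latter take values in `{0, 1}`.
   Furthermore, given `t₀ ∈ Z_R`, there exists `s₀ > 0` …: Let `C_*` denote the subset of `C`
   where `t ∈ (t₀ − s₀, t₀ + s₀)` and `(ρ² + z²)^{1/2} < s₀`. Then `C_* = C_ρ ∪ C_{z+} ∪ C_{z−}`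
   where: 1. If `q_± = 0`, then `C_{z±}` is empty; otherwise `C_{z±}` is the restriction of
   `{x = y = 0 and ±z > 0}`. 2. `C_ρ` consists of a finite set of components … 3. (a) Where
   `ρ < s₀`, the pair of functions `(t, ρ)` give a proper embedding of `C'` into
   `(t₀ − s₀, t₀ + s₀) × (0, s₀)`. (b) The restrictions of `z` and `φ = arctan(y, x)` to `C'`
   extend … to where `ρ = 0` as real analytic functions."  A proper embedding of a connected
   surface into the (connected, 2-dimensional) open rectangle is onto, so each `C'` is the full
   graph `{(t, ρ cos φ(t, ρ), ρ sin φ(t, ρ), z(t, ρ)) : |t − τ| < ε, 0 < ρ < ε}`; the number of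
   graphs (`= p`) and the presence of `C_{z±}` (`= q_±`) do not depend on the regular point.  We
   record the decomposition in the box `{|t − τ| < ε, ρ < ε, |z| < ε}` with SQUARE cross-section:
   Prop. 7.1's `C_*` has the round cross-section `ρ² + z² < s₀²`, for which "graph over the full
   rectangle" cannot hold literally when `z ≢ 0` (points with `ρ → s₀`, `z ≠ 0` leave `C_*`); as
   `|z| < s₀/100` on `C_ρ` (Prop. 7.1 (2)), the description of `C_*` for `s₀` gives the recorded
   one for `ε = s₀/√2` (the square box lies in `C_*`, and over `|t − τ| < ε`, `0 < ρ < ε` the graphs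
   have `ρ² + z² < s₀²`).
   `N` is recorded as a natural number (the printed "positive" must be read "non-negative":
   the finite-energy subvariety `{t = c, f = c' > 0}` of Example 1.6 "misses an entire
   neighborhood of `Z`").  The `ρ²`-coefficient of `z` is Thm. 1.8's `4⁻¹ φ₀'(t)` (Prop. 7.1 (c)
   prints `φ₀''`, a misprint: Example 1.7 has `φ₀(t) = (p/q) t + α` and `z = (p/4q) ρ² + O(ρ⁴)`
   by (1.13), and the leading order of the `J`-curve equation `H_f = ρ² Φ_t` in the coordinates
   `(t, f, h, φ)` of (1.10)–(1.11) gives the same).  The `O(·)` are recorded for fixed `t` as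
   `ρ → 0⁺`.  → `taubes_finiteEnergy_regularPoints`.
5. **Prop. 3.2 (§3; lit pp. 10–11), dilation limits, AT THE LEVEL OF SETS.**  With (3.1)
   `C_s = {(t, x, y, z) ∈ B(R) : s·(t, x, y, z) ∈ C ∩ B(R s)}` (the point `t₀ ∈ Z` "again call[ed]
   0", `R ≥ 2`): "Let `{sᵢ}` be a countable, decreasing sequence of `s` values with limit zero. This
   sequence has a subsequence for which the corresponding set `{C_s}` geometrically converges in
   each `Y = B(2) − Z` to a finite energy, pseudo-holomorphic submanifold `C₀ ⊂ B(2) − Z`.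
   Furthermore, each connected component of `C₀` in `B(1) − Z` is identical to the intersection of
   `B(1) − Z` with one of the submanifolds from Example 1.3, 1.4 or 1.5."  Def. 3.1, second bullet:
   "for each compact subset `K ⊂ Y`, introduce the number `d_K(s)` which is the supremum over pairs
   `(x, y) ∈ (C_s ∩ K) × (C₀ ∩ K)` of the sum of the distances from `x` to `C₀` and `y` to `C_s`.
   Then … require that the limit as `s → 0` of `d_K(s)` exists and is zero."  Recorded: the
   subsequence, a limit SET `C₀ ⊆ B(2) ∖ Z`, `d_K → 0`, and `C₀ ∩ (B(1) ∖ Z)` = a finite union of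
   model cones ∩ `(B(1) ∖ Z)` (finiteness: proof of Prop. 3.2, and the finite sums of (4.1)); the
   cones are Example 1.3 `S¹ × λ_ν` (`z = 0`, `(x, y)` on an open ray), Example 1.4 (`x = y = 0`,
   `±z > 0`) and Example 1.5 (1.7) "`t = t₀ ± s (3/2) u'(τ)`, `z = ± s u(τ)`,
   `ρ = s c^{1/2} |u(τ)|^{−1/2}`, `φ = τ`", `s > 0`, `τ ∈ ℝ`, for `c ∈ (0, 2/3^{3/2}]` and `u > 0`
   solving (1.6) `u'' + (4/9)u − (2/9)c u⁻² = 0` "with the normalization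
   `(9/4)(u')² + u² + c/u = 1`" (the requirement that the period of `u` lie in `2πℚ`, which makes
   the cone close up, is dropped — a longer list of candidate cones, a weaker statement; checked
   numerically: with the `ω`-compatible `J` above, (1.7) is `J`-holomorphic exactly with the
   printed, correlated signs `(±, ±)` and `φ = +τ`).
   → `taubes_finiteEnergy_dilationLimits`.

## Deliberately NOT typed here (`TODO(general form)`)

* The first bullet of Def. 3.1 (weak convergence of `C_s` as integer-multiplicity rectifiable
  CURRENTS to `Σ m_{C'} C'`), that the limit `C₀` is itself a finite-energy submanifold, Prop. 4.1
  (every limit current is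
  `Σ_{i≤p} C_ρ^{(i)} + q_+ C_{z+} + q_- C_{z−} + Σ_{i≤n_+} C_{h+}^{(i)} + Σ_{i≤n_-} C_{h−}^{(i)}`
  with `p, q_±, n_±` and the constants `{c^{(i)}}` independent of the subsequence) and hence
  Thm. 1.8's "well defined tangent cones up to the rotation `φ → φ + constant`" with
  multiplicities: typing them needs currents; items 3 (the density `lim_{s→0} s⁻³ σ(s)` exists)
  and 5 are the honest typable consequences.
* Prop. 3.3 (local Gromov compactness), Lemma 3.4 (`c⁻¹ r² ≤ ∫_{B(x,r) ∩ C} ω ≤ c r²`),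
  Props. 5.1–5.2, 6.1, 7.2, 9.1–9.2 (inputs of item 4), Lemmas 1.9–1.10, Examples 1.6–1.7, the
  structure of `C` near `Z_s` ("planned sequel"), and the Riemannian generalisation of §1.c (the
  tree has the Honda/Perutz normal form: `HondaModelNearSymplectic.lean`,
  `NearSymplecticPuncturedSphere.lean`).
* No `theorem …_holds`: these are deep results.

Searched (`lean search`, 2026-08-17): `TaubesDegenerate`, `finiteEnergy`, `subvariet`,
`tangentCone`, `hausdorffMeasure`, `Taubes1998S1B3` — the only prior Taubes-1998 vocabulary is
`HondaUntwistedModel.lean` (reused); no subvarieties, no energy (the tree's `IsJHolomorphicOn` /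
`IsJHolomorphicFlat` are for maps from open subsets of `ℂ` with a CONTINUOUS-LINEAR-valued `J`;
here `J` is the explicit `g⁻¹ hondaDualVec`, singular on `Z`, so the Cauchy–Riemann clause is
inlined as in the Summit packages `IsFlatTransparentFoliation.leaves`).

## References

* C. H. Taubes, *The structure of pseudo-holomorphic subvarieties for a degenerate almost complex
  structure and symplectic form on `S¹ × B³`*, Geom. Topol. 2 (1998) 221–332, arXiv:math/9901142:
  §1 (1.1)–(1.7), Def. 1.1, Def. 1.2, Examples 1.3–1.7, Thm. 1.8; §2 (2.1)–(2.3), Prop. 2.1,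
  Prop. 2.2; §3 (3.1), Def. 3.1, Prop. 3.2; §4 Prop. 4.1; §7 Prop. 7.1 [Taubes1998S1B3].
* K. Honda, *Local properties of self-dual harmonic 2-forms on a 4-manifold*, J. reine angew.
  Math. 577 (2004) 105–116, §4 Thm. 4 (A) (the model `ω_A` = (1.1), via `HondaUntwistedModel.lean`)
  [Honda2004LocalSD].
-/

noncomputable section

open scoped ContDiff Manifold
open _root_.MeasureTheory _root_.Filter _root_.Asymptotics Set
open scoped _root_.Topology

namespace Literature.Geometry.Symplectic

/-- Local notation for the model space `ℝ⁴ = EuclideanSpace ℝ (Fin 4)`, coordinates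
`w = (t, x, y, z) = (w 0, w 1, w 2, w 3)`. -/
local notation "E4" => EuclideanSpace ℝ (Fin 4)

/-- **Finite-energy pseudo-holomorphic subvariety of `S¹ × (B³(δ) ∖ 0)` for Taubes' degenerate
pair `(ω, J)` (Taubes 1998, Def. 1.1 + Def. 1.2), on the periodic lift.**  `C ⊆ ℝ⁴` is the lift of
a finite-energy pseudo-holomorphic subvariety of `(ℝ/2πℤ) × (B³(δ) ∖ 0)`: `C` lies in the
punctured tube `X_δ = {0 < x² + y² + z² < δ²}`, is invariant under `t ↦ t ± 2π`, is closed in `X_δ`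
(Def. 1.1, first bullet), is the image of a proper `J`-holomorphic map `f : C₀ → X_δ` of a
Hausdorff complex curve `C₀` (a `ChartedSpace ℂ` type with holomorphic transition maps; `f` smooth
with `d(f∘e⁻¹)(iζ) = J(d(f∘e⁻¹)ζ)` in every chart `e`, `J` the `ω`-compatible structure
`J ∂_t = g⁻¹(x∂_x + y∂_y − 2z∂_z)`, … of the module docstring, `= −(1.4)` as printed, same
subvarieties) which is a smooth embedding off a countable set `Λ ⊆ C₀` (Def. 1.1, second bullet)
and on which the deck translation is a holomorphic homeomorphism `γ`, `f ∘ γ = f + 2π ∂_t` (so that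
`(C₀, f)` descends to a smooth model of the quotient — module docstring), and one period has finite
energy `∫_{C ∩ {0 ≤ t < 2π}} g dμH[2] < ∞`, `g = (x² + y² + 4z²)^{1/2}` (Def. 1.2: `∫_C ω < ∞`;
"`ω` on `TC` is equal to `g` times the area form", §2).  Junk: `·/g` with `g = 0` only on `Z`,
which `X_δ` misses. [cite: Taubes1998S1B3, Def. 1.1 and Def. 1.2] -/
def IsTaubesFiniteEnergySubvariety (δ : ℝ) (C : Set E4) : Prop :=
  -- Taubes' norm function `g = |ω|/√2 = (x² + y² + 4z²)^{1/2}` (1.3)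
  let g : E4 → ℝ := fun w => Real.sqrt (w 1 ^ 2 + w 2 ^ 2 + 4 * w 3 ^ 2)
  -- the `ω`-compatible almost complex structure `J = g⁻¹ Ω_wᵀ` (`= −(1.4)` as printed):
  -- `hondaDualVec w u = (−dQ(u), x u₀ + 2z u₂ + y u₃, y u₀ − 2z u₁ − x u₃, −2z u₀ − y u₁ + x u₂)`
  let Jt : E4 → E4 → E4 := fun w u => (g w)⁻¹ • hondaDualVec w u
  -- the punctured tube `X_δ = ℝ × (B³(δ) ∖ 0)` and the period vector `2π ∂_t`
  let X : Set E4 := hondaTube δ \ hondaAxis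
  let T : E4 := EuclideanSpace.single 0 (2 * Real.pi)
  C ⊆ X ∧ (∀ w : E4, w ∈ C ↔ w + T ∈ C) ∧ closure C ∩ X ⊆ C ∧
  (∃ (C₀ : Type) (_ : TopologicalSpace C₀) (_ : T2Space C₀) (_ : ChartedSpace ℂ C₀)
      (_ : IsManifold 𝓘(ℂ, ℂ) ω C₀) (f : C₀ → E4) (Λ : Set C₀) (γ : C₀ ≃ₜ C₀),
    range f = C ∧
    -- the deck translation `t ↦ t + 2π` of the lift acts on the smooth model holomorphically
    (ContMDiff 𝓘(ℂ, ℂ) 𝓘(ℂ, ℂ) ω γ ∧ ∀ q : C₀, f (γ q) = f q + T) ∧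
    (∀ K ⊆ X, IsCompact K → IsCompact (f ⁻¹' K)) ∧
    (∀ e ∈ atlas ℂ C₀,
      ContDiffOn ℝ ∞ (f ∘ e.symm) e.target ∧
      ∀ ξ ∈ e.target, ∀ ζ : ℂ,
        fderiv ℝ (f ∘ e.symm) ξ (Complex.I * ζ) =
          Jt (f (e.symm ξ)) (fderiv ℝ (f ∘ e.symm) ξ ζ)) ∧
    Λ.Countable ∧ Topology.IsEmbedding (Λᶜ.restrict f) ∧
    (∀ e ∈ atlas ℂ C₀, ∀ ξ ∈ e.target, e.symm ξ ∉ Λ →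
      Function.Injective (fderiv ℝ (f ∘ e.symm) ξ))) ∧
  (∫⁻ w in C ∩ {w | w 0 ∈ Ico 0 (2 * Real.pi)}, ENNReal.ofReal (g w) ∂μH[2]) < ⊤

/-- **Finite energy ⇒ finite area, with the tube bounds (Taubes 1998, Thm. 1.8 first assertion;
Prop. 2.2).**  For every finite-energy pseudo-holomorphic subvariety `C` of `S¹ × (B³(δ) ∖ 0)`
(periodic lift, `IsTaubesFiniteEnergySubvariety δ C`): one period `C ∩ {0 ≤ t < 2π}` has finite
2-dimensional Hausdorff measure ("`C` has finite area"), and there is `ζ` such that for every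
`s > 0`, with `C(s) = C ∩ {(x² + y² + z²)^{1/2} < s}` restricted to one period,
(a) `∫_{C(s)} g dμH[2] ≤ ζ s²` and (b) `μH[2](C(s)) ≤ ζ s`.  Printed for `S¹ = ℝ/ℤ` and the unit
ball; transcription conventions in the module docstring. Nothing is asserted.
[cite: Taubes1998S1B3, Thm. 1.8 (first assertion) and Prop. 2.2] -/
def taubes_finiteEnergy_finiteArea : Prop :=
  ∀ (δ : ℝ) (C : Set E4), 0 < δ → IsTaubesFiniteEnergySubvariety δ C →
    let g : E4 → ℝ := fun w => Real.sqrt (w 1 ^ 2 + w 2 ^ 2 + 4 * w 3 ^ 2)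
    let P : Set E4 := {w | w 0 ∈ Ico 0 (2 * Real.pi)}
    let Cs : ℝ → Set E4 := fun s => C ∩ P ∩ hondaTube s
    μH[2] (C ∩ P) < ⊤ ∧
    ∃ ζ : ℝ, ∀ s : ℝ, 0 < s →
      (∫⁻ w in Cs s, ENNReal.ofReal (g w) ∂μH[2]) ≤ ENNReal.ofReal (ζ * s ^ 2) ∧
      μH[2] (Cs s) ≤ ENNReal.ofReal (ζ * s)

/-- **Local energy monotonicity at a point of `Z` (Taubes 1998, Prop. 2.1).**  For every
finite-energy pseudo-holomorphic subvariety `C` (periodic lift) and every smooth bump `χ` on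
`[0, ∞)` (non-increasing, `= 1` on `[0, 1)`, `= 0` on `[2, ∞)`), there are `ζ` and `s₀ > 0` such
that for every point `w₀ = (t₀, 0, 0, 0)` of `Z`, the local energy
`σ(s) = ∫_C χ(|w − w₀|/s) g dμH[2]` ((2.1)–(2.2); `|w − w₀| = (t² + ρ² + z²)^{1/2}` after
translating `t₀` to `0`) is differentiable on `(0, s₀)` and for `0 < s < s₀`:
(1) `σ(s) ≤ ζ s³`, (2) `μH[2](C ∩ B(w₀, s)) ≤ ζ s²`, (3) `σ'(s) ≥ (3/s) σ(s)` — so `s⁻³ σ(s)` is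
non-decreasing and the density `lim_{s → 0} s⁻³ σ(s)` exists (proof of Prop. 3.2).  Printed with
the interval `(0, ζ⁻¹)`; recorded with an interval `(0, s₀)` not tied to `ζ` (weaker) and for
smooth `χ`. Nothing is asserted. [cite: Taubes1998S1B3, Prop. 2.1] -/
def taubes_finiteEnergy_localEnergyMonotone : Prop :=
  ∀ (δ : ℝ) (C : Set E4) (χ : ℝ → ℝ), 0 < δ → IsTaubesFiniteEnergySubvariety δ C →
    ContDiff ℝ ∞ χ → AntitoneOn χ (Ici 0) → (∀ r ∈ Ico (0 : ℝ) 1, χ r = 1) →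
    (∀ r : ℝ, 2 ≤ r → χ r = 0) →
    let g : E4 → ℝ := fun w => Real.sqrt (w 1 ^ 2 + w 2 ^ 2 + 4 * w 3 ^ 2)
    ∃ ζ s₀ : ℝ, 0 < s₀ ∧ ∀ t₀ : ℝ,
      let w₀ : E4 := EuclideanSpace.single 0 t₀
      let σ : ℝ → ℝ := fun s => ∫ w in C, χ (dist w w₀ / s) * g w ∂μH[2]
      DifferentiableOn ℝ σ (Ioo 0 s₀) ∧
      ∀ s ∈ Ioo 0 s₀,
        σ s ≤ ζ * s ^ 3 ∧ μH[2] (C ∩ Metric.ball w₀ s) ≤ ENNReal.ofReal (ζ * s ^ 2) ∧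
        3 / s * σ s ≤ deriv σ s

/-- **Structure of a finite-energy subvariety at the regular points of `Z` (Taubes 1998, Thm. 1.8,
main assertion, in the box form of Prop. 7.1).**  For every finite-energy pseudo-holomorphic
subvariety `C` of `S¹ × (B³(δ) ∖ 0)` (periodic lift) there are a finite singular set
`Z_s ⊂ ℝ/2πℤ` (a `Finset ℝ` read mod `2π`), a number `m` of sheets and two flags `bpos, bneg` such
that every `τ ∉ Z_s + 2πℤ` has an `ε > 0` and real-analytic functions
`φᵢ, zᵢ` (`i < m`) on a neighbourhood of the half-open rectangle `(τ − ε, τ + ε) × [0, ε)` with: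
`zᵢ(t, 0) = 0` (straight edge on `Z`), `φᵢ(t, ρ) = φᵢ(t, 0) + O(ρ²)` and
`zᵢ(t, ρ) = 4⁻¹ ∂_tφᵢ(t, 0) ρ² + O(ρ⁴)` as `ρ → 0⁺` (a perturbation of an Example 1.3 half-disc),
and, in the box `{|t − τ| < ε, x² + y² < ε², |z| < ε}`, `C` is the DISJOINT union of the `m`
graphs `{(t, ρ cos φᵢ, ρ sin φᵢ, zᵢ) : |t − τ| < ε, 0 < ρ < ε}` and, iff `bpos` resp. `bneg`, the
Example 1.4 half-discs `{x = y = 0, ±z > 0}` of the box; `N = m + bpos + bneg` is the printed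
number of components, the same at every regular point (Prop. 7.1: `p`, `q_±` constant on `Z_R`),
here allowed to be `0` (Example 1.6).  Quotes, the square cross-section, the `φ₀'`/`φ₀''`
misprint and the conventions: module docstring. Nothing is asserted.
[cite: Taubes1998S1B3, Thm. 1.8 and Prop. 7.1] -/
def taubes_finiteEnergy_regularPoints : Prop :=
  ∀ (δ : ℝ) (C : Set E4), 0 < δ → IsTaubesFiniteEnergySubvariety δ C →
    ∃ (Zs : Finset ℝ) (m : ℕ) (bpos bneg : Bool), ∀ τ : ℝ,
      (∀ k : ℤ, τ + 2 * Real.pi * k ∉ Zs) →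
      ∃ ε : ℝ, 0 < ε ∧ ∃ φ z : Fin m → ℝ × ℝ → ℝ,
        -- the box `C_*` of Prop. 7.1 about `(τ, 0, 0, 0)` and its two vertical half-discs
        let box : Set E4 := {w | |w 0 - τ| < ε ∧ w 1 ^ 2 + w 2 ^ 2 < ε ^ 2 ∧ |w 3| < ε}
        let V : Bool → ℝ → Set E4 := fun b sgn =>
          if b then {w | w ∈ box ∧ w 1 = 0 ∧ w 2 = 0 ∧ 0 < sgn * w 3} else ∅
        -- the graph of `(φ', z')` over the open rectangle, in cylindrical coordinates
        let sheet : (ℝ × ℝ → ℝ) → (ℝ × ℝ → ℝ) → Set E4 := fun φ' z' =>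
          (fun q : ℝ × ℝ =>
              (WithLp.toLp 2 ![q.1, q.2 * Real.cos (φ' q), q.2 * Real.sin (φ' q), z' q] : E4)) ''
            (Ioo (τ - ε) (τ + ε) ×ˢ Ioo 0 ε)
        (∀ i, AnalyticOnNhd ℝ (φ i) (Ioo (τ - ε) (τ + ε) ×ˢ Ico 0 ε) ∧
          AnalyticOnNhd ℝ (z i) (Ioo (τ - ε) (τ + ε) ×ˢ Ico 0 ε)) ∧
        (∀ i, ∀ t ∈ Ioo (τ - ε) (τ + ε),
          z i (t, 0) = 0 ∧
          (fun ρ : ℝ => φ i (t, ρ) - φ i (t, 0)) =O[𝓝[>] 0] (fun ρ : ℝ => ρ ^ 2) ∧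
          (fun ρ : ℝ => z i (t, ρ) - 4⁻¹ * deriv (fun t' : ℝ => φ i (t', 0)) t * ρ ^ 2)
            =O[𝓝[>] 0] (fun ρ : ℝ => ρ ^ 4)) ∧
        C ∩ box = V bpos 1 ∪ V bneg (-1) ∪ ⋃ i, sheet (φ i) (z i) ∧
        (∀ i j, i ≠ j → Disjoint (sheet (φ i) (z i)) (sheet (φ j) (z j)))

/-- **Dilation limits at a point of `Z` are cones of Examples 1.3, 1.4, 1.5 (Taubes 1998,
Prop. 3.2, at the level of sets).**  For every finite-energy pseudo-holomorphic subvariety `C`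
(periodic lift), every point `w₀ = (t₀, 0, 0, 0)` of `Z` and every decreasing sequence `sᵢ → 0⁺`,
some subsequence of the dilations (3.1) `C_s = {w ∈ B(2) : w₀ + s w ∈ C}` converges in Hausdorff
distance on every compact subset of `B(2) ∖ Z` (the second bullet of Def. 3.1:
`sup_{x ∈ C_s ∩ K} dist(x, C₀) + sup_{y ∈ C₀ ∩ K} dist(y, C_s) → 0`, spelled with honest
`∃ y ∈ C₀, dist x y < η` witnesses — no `infDist` junk value at `C₀ = ∅`, which is a legitimate limit
exactly when `C` misses a neighbourhood of `w₀`, Example 1.6) to a set `C₀ ⊆ B(2) ∖ Z` whose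
part in `B(1) ∖ Z` is that of a FINITE union of the model cones with vertex `0`: Example 1.3
`{z = 0, (x, y) ∈ ℝ_{>0}(cos α, sin α)}`, Example 1.4 `{x = y = 0, ±z > 0}`, Example 1.5 (1.7)
`{(±(3/2) s u′(τ), s (c/u(τ))^{1/2} cos τ, s (c/u(τ))^{1/2} sin τ, ±s u(τ)) : s > 0, τ ∈ ℝ}` with
`c ∈ (0, 2/3^{3/2}]` and `u > 0` a solution of (1.6) `u″ + (4/9)u − (2/9)c u⁻² = 0`,
`(9/4)u′² + u² + c/u = 1` (the rational-period condition of Example 1.5, which makes the cone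
close up, is dropped: a larger list, a weaker statement).  NOT recorded (TODO(general form)): the
first bullet of Def. 3.1 (weak convergence as integer-multiplicity currents), that `C₀` is a
finite-energy submanifold, and Prop. 4.1 (independence of `p, q_±, n_±, {c⁽ⁱ⁾}` of the
subsequence).  Nothing is asserted. [cite: Taubes1998S1B3, Prop. 3.2 (with (3.1), Def. 3.1)] -/
def taubes_finiteEnergy_dilationLimits : Prop :=
  ∀ (δ : ℝ) (C : Set E4) (t₀ : ℝ) (s : ℕ → ℝ), 0 < δ → IsTaubesFiniteEnergySubvariety δ C →
    StrictAnti s → (∀ i, 0 < s i) → Tendsto s atTop (𝓝 0) →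
    let w₀ : E4 := EuclideanSpace.single 0 t₀
    -- the dilations (3.1) about `w₀` with `R = 2` (the lifted zero circle is `hondaAxis`)
    let Cdil : ℝ → Set E4 := fun r => {w | w ∈ Metric.ball (0 : E4) 2 ∧ w₀ + r • w ∈ C}
    -- the model cones of Examples 1.3, 1.4 and 1.5 with vertex `0`
    let K13 : ℝ → Set E4 := fun α =>
      {w | w 3 = 0 ∧ ∃ r : ℝ, 0 < r ∧ w 1 = r * Real.cos α ∧ w 2 = r * Real.sin α}
    let K14 : ℝ → Set E4 := fun sgn => {w | w 1 = 0 ∧ w 2 = 0 ∧ 0 < sgn * w 3}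
    let K15 : ℝ → (ℝ → ℝ) → ℝ → Set E4 := fun c u sgn =>
      {w | ∃ r τ : ℝ, 0 < r ∧ w 0 = sgn * (3 / 2) * r * deriv u τ ∧ w 3 = sgn * r * u τ ∧
        w 1 = r * Real.sqrt (c / u τ) * Real.cos τ ∧ w 2 = r * Real.sqrt (c / u τ) * Real.sin τ}
    let IsOrbit : ℝ → (ℝ → ℝ) → Prop := fun c u =>
      0 < c ∧ c ≤ 2 / (3 * Real.sqrt 3) ∧ ContDiff ℝ 2 u ∧ (∀ τ, 0 < u τ) ∧
        (∀ τ, iteratedDeriv 2 u τ + 4 / 9 * u τ - 2 / 9 * c * (u τ)⁻¹ ^ 2 = 0) ∧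
        ∀ τ, 9 / 4 * deriv u τ ^ 2 + u τ ^ 2 + c / u τ = 1
    let IsModelCone : Set E4 → Prop := fun P =>
      (∃ α : ℝ, P = K13 α) ∨ P = K14 1 ∨ P = K14 (-1) ∨
        ∃ (c : ℝ) (u : ℝ → ℝ) (sgn : ℝ), (sgn = 1 ∨ sgn = -1) ∧ IsOrbit c u ∧ P = K15 c u sgn
    ∃ (ψ : ℕ → ℕ) (C₀ : Set E4), StrictMono ψ ∧ C₀ ⊆ Metric.ball (0 : E4) 2 \ hondaAxis ∧
      (∀ K : Set E4, IsCompact K → K ⊆ Metric.ball (0 : E4) 2 \ hondaAxis → ∀ η : ℝ, 0 < η →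
        ∀ᶠ i in atTop,
          (∀ x ∈ Cdil (s (ψ i)) ∩ K, ∃ y ∈ C₀, dist x y < η) ∧
          (∀ y ∈ C₀ ∩ K, ∃ x ∈ Cdil (s (ψ i)), dist x y < η)) ∧
      ∃ (n : ℕ) (P : Fin n → Set E4), (∀ j, IsModelCone (P j)) ∧
        C₀ ∩ (Metric.ball (0 : E4) 1 \ hondaAxis) =
          (⋃ j, P j) ∩ (Metric.ball (0 : E4) 1 \ hondaAxis)

end Literature.Geometry.Symplectic

end
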